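import Summits.Ventures.CertifiedArithmetic.Expansions.CompressReplayStep
import Summits.Ventures.CertifiedArithmetic.Expansions.CompressSweepInduction
import Mathlib.Tactic.Linarith
import Mathlib.Tactic.Positivity
import Mathlib.Tactic.Ring
import Mathlib.Tactic.NormNum

/-!
# COMPRESS under any tie rule: every adjacent pair of the output is a tie replay or mergeable
(new work)

New work of the certified-arithmetic venture (ENGINES group: shared numerical engines serving
client cells; rigour lives in the verifiers; every published number belongs to a client cell's
ledger, not to the engines group).  Theorem 23 of [Shewchuk1997, §2.7]: `COMPRESS(e)` is a
nonoverlapping expansion under every round-to-nearest map, NONADJACENT under round-to-even.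
`CompressAdjacentTiesAway` shows that other tie rules do leave adjacent pairs.  THIS FILE says
exactly what an adjacent pair of a COMPRESS output looks like, for EVERY round-to-nearest map
`fl` (any tie rule) and EVERY precision `p ≥ 2`:

`compress_replayOrMerge`.  For a nonoverlapping expansion `e` of floats, any two consecutive
components `a` (lower), `b` (upper) of `h = COMPRESS(e)` satisfy one of
* `a` lies 2-below `b` (the pair is nonadjacent, as under round-to-even);
* `a + b` is a `p`-bit float (the pair is MERGEABLE: one more exact addition removes it);
* `2|a| = ulp b` and `b` is an ODD multiple of `ulp b` (a TIE REPLAY: `b + a` is the midpoint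
  of two consecutive floats and `(a, b)` = (roundoff, result) of the rounding `b = fl(b + a)`
  that some step of the sweep performed — the resolution round-to-even never chooses).
The last two kinds exclude each other (`TieReplay.not_isFloat_add`: a tie replay with a float
lower member is never mergeable), matching the count "never both" below.

PROOF = the venture's two previous files assembled: the state property `RepInv` (the chain of
this relation along the emitted components, read downwards, plus the record "the newest
roundoff sits below a grid `2^u` carrying the normal carry") is STABLE in the sense of
`CompressSweepInduction` — the emitting step is the local replay-or-merge lemma
`fastTwoSum_replay_or_mergeable` of `CompressReplayStep`, the exact step and the new grid
record are ulp bookkeeping — and `compress_induction` runs the sweep; the final pair (newest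
roundoff, top component) is a tie replay or nonadjacent by the grid record alone
(`tieReplay_of_not_below`).  HONEST FRAMING: nothing here is claimed by the paper; the
statement was found experimentally (integer model, `p = 2..6`, seven tie rules incl. random
tie decisions: 28 175 adjacent consecutive pairs among 498 467, each mergeable (2 553) or a tie
replay (25 622), never both, no exception; script `vreplay_out.py` of the engines desk) and is
proved here for all `p ≥ 2`.
-/

namespace Summit.Ventures.CertifiedArithmetic.Expansions

open Literature.ComputerArithmetic.JeannerodRump2018
open Literature.ComputerArithmetic.BoldoJeannerodMelquiondMuller2023 hiding twoSum twoSum_fst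
open Literature.ComputerArithmetic.Shewchuk1997
open Literature.ComputerArithmetic

variable {p : ℕ} {emin : ℤ} {fl : ℚ → ℚ}

/-! ### The relation along the output -/

/-- `(a, b)` is a TIE REPLAY: `|a|` is half an ulp of `b` and `b` is an odd multiple of its ulp
(so `b + a` is the midpoint of two consecutive floats, resolved to the odd side).
[cite: Shewchuk1997, Thm 23 p. 333; BoldoEtAl2023, §2.1] -/
def TieReplay (p : ℕ) (emin : ℤ) (a b : ℚ) : Prop :=
  2 * |a| = ulp p emin b ∧ ∃ u : ℤ, ulp p emin b = (2 : ℚ) ^ u ∧ OnGrid u b ∧ ¬ OnGrid (u + 1) b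

/-- The relation between consecutive components of a COMPRESS output under any tie rule:
nonadjacent, or mergeable, or a tie replay. [cite: Shewchuk1997, Thm 23 p. 333] -/
def ReplayOrMerge (p : ℕ) (emin : ℤ) (a b : ℚ) : Prop :=
  Below 2 a b ∨ IsFloat p emin (a + b) ∨ TieReplay p emin a b

/-- THE FINAL PAIR.  A float `r` below a grid `2^u ≥ 2^emin` (`2|r| ≤ 2^u`) carrying a normal
float `Q` (`Q ∈ 2^uℤ`, `|Q| ≥ 2^(p−1)·2^u`) either lies 2-below `Q` or forms a tie replay with
it: adjacency forces `2|r| = 2^u` and `Q ∉ 2^(u+1)ℤ`, whence `ulp Q = 2^u`.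
[cite: Shewchuk1997, Thm 23 p. 333; BoldoEtAl2023, §2.1] -/
theorem tieReplay_of_not_below (hp : 1 ≤ p) {r Q : ℚ} {u : ℤ} (hu : emin ≤ u)
    (huQ : OnGrid u Q) (hr : 2 * |r| ≤ (2 : ℚ) ^ u) (hQbig : (2 : ℚ) ^ u * 2 ^ (p - 1) ≤ |Q|)
    (hQ : IsFloat p emin Q) (h : ¬ Below 2 r Q) : TieReplay p emin r Q := by
  have hr2 : 2 * |r| = (2 : ℚ) ^ u := by
    refine le_antisymm hr (not_lt.mp fun hlt => h ⟨u, huQ, hlt⟩)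
  have hodd : ¬ OnGrid (u + 1) Q := fun hQ' =>
    h ⟨u + 1, hQ', by rw [hr2]; exact zpow_lt_zpow_right₀ (by norm_num) (by omega)⟩
  have hulpQ : ulp p emin Q = (2 : ℚ) ^ u :=
    le_antisymm (JeannerodLouvetMuller2013.ulp_le_two_zpow hu
        (abs_lt_of_isFloat_of_not_onGrid hQ hodd))
      (JeannerodLouvetMuller2013.two_zpow_le_ulp hp (by rw [mul_comm]; exact hQbig))
  exact ⟨by rw [hulpQ, hr2], u, hulpQ, huQ, hodd⟩

/-- THE TWO ADJACENT KINDS EXCLUDE EACH OTHER (`p ≥ 2`): if `(a, b)` is a tie replay and `a` is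
a float then `a + b` is NOT a float — `|a| = 2^(u−1)` is a float only if `u > emin`, so `b` is
normal on `2^u` with an odd significand `|m| ≥ 2^(p−1) + 1`, hence `|a + b| ≥ 2^(p−1)·2^u`; a
float that large lies on the grid `2^u`, and then so would `a = (a + b) − b`, contradicting
`0 < |a| < 2^u`.  (Observed first: among 28 175 adjacent output pairs none was both.)
[cite: BoldoEtAl2023, §2.1; Shewchuk1997, Thm 23 p. 333] -/
theorem TieReplay.not_isFloat_add (hp : 2 ≤ p) {a b : ℚ} (h : TieReplay p emin a b)
    (ha : IsFloat p emin a) : ¬ IsFloat p emin (a + b) := by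
  have hp1 : 1 ≤ p := by omega
  obtain ⟨h2, u, hU, ⟨m, hm⟩, hodd⟩ := h
  rw [hU] at h2
  have h2ne : (2 : ℚ) ≠ 0 := by norm_num
  have hA : (0 : ℚ) < 2 ^ u := zpow_pos (by norm_num) u
  have habs : |a| = (2 : ℚ) ^ (u - 1) := by rw [zpow_sub_one₀ h2ne]; linarith
  have hue : emin ≤ u - 1 := GraillatMuller2025.emin_le_of_abs_eq_two_zpow ha habs
  -- `b` is normal on the grid `2^u`
  have hbig : (2 : ℚ) ^ u * 2 ^ (p - 1) ≤ |b| := by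
    rcases lt_or_ge |b| ((2 : ℚ) ^ (emin + p - 1)) with hs | hn
    · have h1 := ulp_eq_of_abs_lt (p := p) hs
      rw [hU] at h1
      have := (zpow_right_injective₀ (by norm_num) (by norm_num : (2 : ℚ) ≠ 1)) h1
      omega
    · have := ulp_le_of_normal hp1 hn
      rw [hU, le_div_iff₀ (by positivity)] at this
      exact this
  -- its significand `m` is odd, hence `|m| ≥ 2^(p−1) + 1`
  have hm1 : (2 : ℤ) ^ (p - 1) ≤ |m| := by
    have : (2 : ℚ) ^ (p - 1) * 2 ^ u ≤ |(m : ℚ)| * 2 ^ u := by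
      have h := hbig; rwa [hm, abs_mul, abs_of_pos hA, mul_comm ((2 : ℚ) ^ u)] at h
    exact_mod_cast le_of_mul_le_mul_right this hA
  have hmodd : ¬ 2 ∣ m := by
    rintro ⟨k, rfl⟩
    exact hodd ⟨k, by rw [hm, zpow_add_one₀ h2ne]; push_cast; ring⟩
  have h2p : (2 : ℤ) ^ (p - 1) = 2 * 2 ^ (p - 2) := by
    rw [← pow_succ']; congr 1; omega
  have hm2 : (2 : ℤ) ^ (p - 1) + 1 ≤ |m| := by
    rw [h2p] at hm1 ⊢; rcases abs_cases m with ⟨h', -⟩ | ⟨h', -⟩ <;> rw [h'] at hm1 ⊢ <;> omega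
  -- so `|a + b| ≥ 2^(p−1)·2^u`
  have hsum : (2 : ℚ) ^ (p - 1) * 2 ^ u ≤ |a + b| := by
    have i1 : |b| - |a| ≤ |a + b| := by
      have := abs_sub_abs_le_abs_sub b (-a)
      rwa [abs_neg, sub_neg_eq_add, add_comm] at this
    have hmq : (2 : ℚ) ^ (p - 1) + 1 ≤ |(m : ℚ)| := by exact_mod_cast hm2
    have hbm : |b| = |(m : ℚ)| * 2 ^ u := by rw [hm, abs_mul, abs_of_pos hA]
    rw [habs, zpow_sub_one₀ h2ne] at i1
    nlinarith [mul_le_mul_of_nonneg_right hmq hA.le]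
  -- a float that large lies on the grid `2^u`, and then so does `a`: contradiction
  intro hF
  have hgrid : OnGrid u (a + b) :=
    onGrid_of_two_zpow_le_ulp hF (JeannerodLouvetMuller2013.two_zpow_le_ulp hp1 hsum)
  have ha_grid : OnGrid u a := by
    have := hgrid.sub ⟨m, hm⟩
    rwa [add_sub_cancel_right] at this
  have ha0 : a ≠ 0 := by rw [← abs_pos, habs]; exact zpow_pos (by norm_num) _
  have := ha_grid.two_zpow_le_abs ha0
  rw [habs] at this
  have := (zpow_le_zpow_iff_right₀ (by norm_num : (1 : ℚ) < 2)).mp this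
  omega

/-! ### The stable state property -/

/-- STATE PROPERTY of the upward sweep (`rs` newest first, `Q` the carry): the relation
`ReplayOrMerge` holds along the emitted components read downwards, and the newest roundoff sits
below a grid `2^u ≥ 2^emin` on which the carry is normal (`Q ∈ 2^uℤ`, `|Q| ≥ 2^(p−1)·2^u`,
`2|r| ≤ 2^u`). [cite: Shewchuk1997, Thm 23 p. 333 (proof); BoldoEtAl2023, §2.1] -/
structure RepInv (p : ℕ) (emin : ℤ) (rs : List ℚ) (Q : ℚ) : Prop where
  /-- the relation along the emitted components, newest to oldest
  [cite: Shewchuk1997, Thm 23 p. 333] -/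
  chain : rs.IsChain (flip (ReplayOrMerge p emin))
  /-- the newest roundoff sits below a grid on which the carry is normal
  [cite: Shewchuk1997, Thm 23 p. 333 (proof, Line 12); BoldoEtAl2023, §2.1] -/
  hd : ∀ r ∈ rs.head?, ∃ u : ℤ, emin ≤ u ∧ OnGrid u Q ∧ 2 * |r| ≤ (2 : ℚ) ^ u ∧
    (2 : ℚ) ^ u * 2 ^ (p - 1) ≤ |Q|

/-- The property holds at every empty state. [cite: Shewchuk1997, Thm 23 p. 333 (proof)] -/
theorem RepInv.nil (Q : ℚ) : RepInv p emin [] Q where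
  chain := List.IsChain.nil
  hd := by simp

/-- THE NEW GRID RECORD after an emitting step (`p ≥ 2`): the emitted roundoff `q` sits below the
grid `2^k = ulp(g + Q)` (`|q| ≤ ulp(g + Q)/2`), which carries the new carry `x = fl(g + Q)`,
and `x` is normal on it because `g + Q` is (`|g + Q| ≥ |g| − ulp g ≥ 2^(emin+p−1)`).
[cite: Shewchuk1997, Thm 23 p. 333 (proof); BoldoEtAl2023, §2.1] -/
theorem grid_record_emit (hp : 2 ≤ p) (hfl : IsRoundNearest p emin fl) {Q g : ℚ}
    (hQ : IsFloat p emin Q) (hg : IsFloat p emin g) (hgbig : (2 : ℚ) ^ (emin + p) ≤ |g|)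
    (hQg : |Q| ≤ ulp p emin g) :
    ∃ u : ℤ, emin ≤ u ∧ OnGrid u (fastTwoSum fl g Q).1 ∧
      2 * |(fastTwoSum fl g Q).2| ≤ (2 : ℚ) ^ u ∧
      (2 : ℚ) ^ u * 2 ^ (p - 1) ≤ |(fastTwoSum fl g Q).1| := by
  have hp1 : 1 ≤ p := by omega
  have hg0 : g ≠ 0 := abs_pos.mp ((zpow_pos two_pos _).trans_le hgbig)
  have hQleg : |Q| ≤ |g| := hQg.trans (ulp_le_abs_of_isFloat hg hg0)
  obtain ⟨h1, -, h2, -⟩ := fastTwoSum_exact hp1 hfl hg hQ hQleg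
  obtain ⟨k, hk, hK⟩ := exists_ulp_eq_two_zpow (p := p) (emin := emin) (g + Q)
  refine ⟨k, hk, ?_, ?_, ?_⟩
  · obtain ⟨K, hK'⟩ := exists_fl_eq_int_mul_ulp hp1 hfl (g + Q)
    exact ⟨K, by rw [h1, hK', hK]⟩
  · rw [h2, ← hK]; linarith [abs_sub_fl_le_half_ulp hp1 hfl (g + Q)]
  · have hgQ : |g| - |Q| ≤ |g + Q| := by
      have := abs_sub_abs_le_abs_sub g (-Q)
      rwa [abs_neg, sub_neg_eq_add] at this
    have hg2 : (2 : ℚ) ^ (emin + p - 1) * 2 ≤ |g| := by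
      rw [← zpow_add_one₀ two_ne_zero, show emin + p - 1 + 1 = emin + (p : ℤ) by ring]
      exact hgbig
    have hn' : (2 : ℚ) ^ (emin + p - 1) ≤ |g| := by
      linarith [zpow_pos (by norm_num : (0 : ℚ) < 2) (emin + p - 1)]
    have hUg : ulp p emin g * 2 ^ (p - 1) ≤ |g| :=
      (le_div_iff₀ (by positivity)).mp (ulp_le_of_normal hp1 hn')
    have hP2 : (2 : ℚ) ≤ 2 ^ (p - 1) :=
      calc (2 : ℚ) = 2 ^ 1 := by norm_num
        _ ≤ 2 ^ (p - 1) := pow_le_pow_right₀ (by norm_num) (by omega)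
    have hn : (2 : ℚ) ^ (emin + p - 1) ≤ |g + Q| := by
      nlinarith [ulp_pos (p := p) (emin := emin) g]
    have hU : ulp p emin (g + Q) * 2 ^ (p - 1) ≤ |g + Q| :=
      (le_div_iff₀ (by positivity)).mp (ulp_le_of_normal hp1 hn)
    have hf : IsFloat p emin (ulp p emin (g + Q) * 2 ^ (p - 1)) := by
      rw [hK, ← zpow_natCast, ← zpow_add₀ two_ne_zero]
      exact ⟨1, k + ((p - 1 : ℕ) : ℤ),
        by rw [abs_one]; exact_mod_cast Nat.one_lt_two_pow (by omega), by omega, by simp⟩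
    have hpos : 0 < ulp p emin (g + Q) * 2 ^ (p - 1) := by
      have := ulp_pos (p := p) (emin := emin) (g + Q); positivity
    have key := abs_le_abs_fl hfl hf (t := g + Q) (by rw [abs_of_pos hpos]; exact hU)
    rw [abs_of_pos hpos, hK] at key
    rw [h1]; exact key

/-- `RepInv` IS STABLE (`p ≥ 2`, any round-to-nearest).  Exact step: the carry `x = g + Q`
stays on the recorded grid (`g ∈ 2^uℤ` since `2^u ≤ |Q| ≤ ulp g`) and grows.  Emitting step:
the new link `ReplayOrMerge r q` between the old head `r` and the emitted `q` is the local
lemma `fastTwoSum_replay_or_mergeable` — in its identity branch `q = Q`, so the pair `(r, Q)`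
is adjacent and `tieReplay_of_not_below` applies —, and the new record is `grid_record_emit`.
[cite: Shewchuk1997, Thm 23 p. 333 (proof); JeannerodRump2018, App. B; BoldoEtAl2023, §2.1] -/
theorem repInv_upStable (hp : 2 ≤ p) (hfl : IsRoundNearest p emin fl) :
    UpStable p emin fl 1 (RepInv p emin) where
  absorb {rs Q g} inv rinv hg hgbig hQg hq := by
    obtain ⟨-, hx, hge⟩ := inv.absorb hp hfl hg hgbig hQg hq
    refine ⟨rinv.chain, fun r hr => ?_⟩
    obtain ⟨u, hu, huQ, hr2, hQbig⟩ := rinv.hd r hr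
    have h2u : (2 : ℚ) ^ u ≤ |Q| :=
      le_trans (le_mul_of_one_le_right (zpow_nonneg (by norm_num) u)
        (one_le_pow₀ (by norm_num))) hQbig
    have hgu : OnGrid u g := onGrid_of_two_zpow_le_ulp hg (h2u.trans hQg)
    exact ⟨u, hu, by rw [hx]; exact hgu.add huQ, hr2, hQbig.trans hge⟩
  emit {rs Q g} inv rinv hg hgbig hQg hq := by
    have hp1 : 1 ≤ p := by omega
    refine ⟨List.isChain_cons.mpr ⟨fun r hr => ?_, rinv.chain⟩, fun r hr => ?_⟩
    · -- the new link between the old head `r` and the emitted roundoff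
      show ReplayOrMerge p emin r (fastTwoSum fl g Q).2
      by_cases hb : Below 2 r (fastTwoSum fl g Q).2
      · exact Or.inl hb
      obtain ⟨u, hu, huQ, hr2, hQbig⟩ := rinv.hd r hr
      have hrF : IsFloat p emin r := by
        cases rs with
        | nil => simp at hr
        | cons r₀ t =>
          simp only [List.head?_cons, Option.mem_def, Option.some.injEq] at hr
          subst hr; exact inv.floats _ (by simp)
      rcases fastTwoSum_replay_or_mergeable hp hfl hu huQ hr2 hQbig inv.hQ hrF hg hQg hb with
        ⟨heq, -, -⟩ | hF
      · have hqQ : (fastTwoSum fl g Q).2 = Q := by rw [heq]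
        rw [hqQ] at hb ⊢
        exact Or.inr (Or.inr (tieReplay_of_not_below hp1 hu huQ hr2 hQbig inv.hQ hb))
      · exact Or.inr (Or.inl hF)
    · -- the new grid record
      simp only [List.head?_cons, Option.mem_def, Option.some.injEq] at hr
      subst hr
      exact grid_record_emit hp hfl inv.hQ hg hgbig hQg

/-! ### The theorem -/

/-- **EVERY ADJACENT PAIR OF A COMPRESS OUTPUT IS A TIE REPLAY OR MERGEABLE** (any
round-to-nearest `fl`, any tie rule, every `p ≥ 2`).  For a nonoverlapping expansion `e` of
floats, consecutive components `a, b` of `COMPRESS(e)` satisfy: `a` lies 2-below `b`, or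
`a + b` is a float, or `2|a| = ulp b` with `b` an odd multiple of `ulp b`.
[cite: Shewchuk1997, Thm 23 p. 333; JeannerodRump2018, App. B; BoldoEtAl2023, §2.1] -/
theorem compress_replayOrMerge (hp : 2 ≤ p) (hfl : IsRoundNearest p emin fl) {e : List ℚ}
    (he : ∀ x ∈ e, IsFloat p emin x) (hexp : IsExpansion 1 e) :
    (compress fl e).IsChain (ReplayOrMerge p emin) := by
  have hp1 : 1 ≤ p := by omega
  by_cases hne : e = []
  · subst hne; simp [compress]
  obtain ⟨rs, Q, hcomp, inv, rinv⟩ := compress_induction hp hfl le_rfl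
    (roundoffBelow_one hp1 hfl) (repInv_upStable hp hfl) RepInv.nil he hexp hne
  rw [hcomp]
  refine isChain_output rinv.chain fun r hr => ?_
  by_cases hb : Below 2 r Q
  · exact Or.inl hb
  obtain ⟨u, hu, huQ, hr2, hQbig⟩ := rinv.hd r hr
  exact Or.inr (Or.inr (tieReplay_of_not_below hp1 hu huQ hr2 hQbig inv.hQ hb))

/-- Pointwise form: an ADJACENT consecutive pair `a, b` of `COMPRESS(e)` whose sum is not a
float is a tie replay — `|a| = ulp(b)/2` and `b` is an odd multiple of `ulp b`.
[cite: Shewchuk1997, Thm 23 p. 333] -/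
theorem compress_adjacent_tieReplay (hp : 2 ≤ p) (hfl : IsRoundNearest p emin fl)
    {e : List ℚ} (he : ∀ x ∈ e, IsFloat p emin x) (hexp : IsExpansion 1 e)
    {t₁ t₂ : List ℚ} {a b : ℚ} (hab : compress fl e = t₁ ++ a :: b :: t₂)
    (hadj : ¬ Below 2 a b) (hnm : ¬ IsFloat p emin (a + b)) : TieReplay p emin a b := by
  have hch := compress_replayOrMerge hp hfl he hexp
  rw [hab] at hch
  have hpair : ReplayOrMerge p emin a b := by
    have h2 : (a :: b :: t₂).IsChain (ReplayOrMerge p emin) :=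
      (List.isChain_append.mp hch).2.1
    exact (List.isChain_cons_cons.mp h2).1
  rcases hpair with h | h | h
  · exact absurd h hadj
  · exact absurd h hnm
  · exact h

end Summit.Ventures.CertifiedArithmetic.Expansions
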